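import Summits.Ventures.PackingBounds.Configurations.KissingConstructionA
import Summits.Ventures.PackingBounds.ThreePointCert.C8TProof
import Summits.Ventures.PackingBounds.ThreePointCert.C9TProof
import Summits.Ventures.PackingBounds.ThreePointCert.C10TProof

/-!
# `A(8, arccos 1/3) ≥ 64`, `A(9, arccos 1/3) ≥ 96`, `A(10, arccos 1/3) ≥ 104` from Construction A

Framing: lottery ticket; floor = certified bounds/negative ranges. Venture `PackingBounds` (cell
`pub-packcert`, seat `pub-packcert-energy`) — attained side of the cell's `A(n, arccos 1/3)` table (Conway–Sloane,
*SPLAG* Ch. 9 Table 9.2: how many spheres can touch two touching spheres; lower bounds `64` (`n = 8`), `96` (`n = 9`)).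

In a Construction A packing (`KissingConstructionA.lean`: blocks = `4`-subsets of `{0,…,n−1}` pairwise meeting in
`≤ 2` points, local vectors `±2e_i` and `(±1)⁴` on the blocks) the spheres touching both the centre and the sphere
at `2e_c` are the `(±1)⁴`-vectors on the `r` blocks through `c` with sign `+` at `c`; projected to `c^⊥` they are the
`8r` vectors `(±1)³` on the REDUCED blocks (block minus `c`): `3`-subsets of the remaining `n − 1` cells pairwise
meeting in `≤ 1` cell, hence unit vectors of `ℝⁿ⁻¹` with pairwise inner products in `{1/3, 0, −1/3, −1}`. This file
proves the generic statement (`exists_code_third`: `N` three-subsets of `{0,…,m−1}` pairwise meeting in at most one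
point give `8N` unit vectors of `ℝᵐ` with pairwise inner products `≤ 1/3`) and instantiates it with the reduced
blocks through the last point of the tree's `blk9` (`P₉ₐ`, `r = 8`), `blk10` (`P₁₀b = S(3,4,10)`, `r = 12`) and
`blk11` (`P₁₁c`, `r = 13`): **`A(8, arccos 1/3) ≥ 64`**, **`A(9, arccos 1/3) ≥ 96`** (the Table 9.2 values) and
`A(10, arccos 1/3) ≥ 104`, with the brackets `64–74`, `96–99`, `104–135` from the cell's kernel-checked three-point
bounds.

## References
* J. H. Conway, N. J. A. Sloane, *Sphere Packings, Lattices and Groups*, Ch. 9 Table 9.2; Ch. 5 §2.6. [`ConwaySloane1999`]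
-/

namespace Summit.Ventures.PackingBounds.Config.ConsA

open Finset Leech Golay CL17

/-! ### The generic configuration: all sign patterns on `3`-subsets -/

/-- All `(±1)³` vectors on the `3`-subsets `supp (tb b)`, `b < N`. [cite: ConwaySloane1999, Ch. 5 §2.6] -/
def thirdConf (N : ℕ) (tb : ℕ → ℕ) : Finset (Fin 24 → ℤ) := (range N).biUnion fun b => blockVecs (supp (tb b))

section Generic

variable {m N : ℕ} {tb : ℕ → ℕ}

/-- Supports of the triples are cells (`m ≤ 16`). -/
theorem supp_tb_sub (hm : m ≤ 16) (htb : ∀ b < N, popK 24 24 (tb b) = 3 ∧ tb b < 2 ^ m) {b : ℕ} (hb : b < N) :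
    supp (tb b) ⊆ cells :=
  fun _ hj => mem_cells.mpr (lt_of_lt_of_le (val_lt_of_mem_supp_lt (htb b hb).2 hj) hm)

/-- Triples have `3` cells. -/
theorem card_supp_tb (htb : ∀ b < N, popK 24 24 (tb b) = 3 ∧ tb b < 2 ^ m) {b : ℕ} (hb : b < N) :
    (supp (tb b)).card = 3 := by
  have h := (htb b hb).1
  rw [← wt_eq_popK] at h; exact h

/-- Distinct triples meet in `≤ 1` cell. -/
theorem card_tb_inter (hint : ∀ b < N, ∀ b' < N, b = b' ∨ popK 24 24 (tb b &&& tb b') ≤ 1) {b b' : ℕ}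
    (hb : b < N) (hb' : b' < N) (hne : b ≠ b') : (supp (tb b) ∩ supp (tb b')).card ≤ 1 := by
  rw [card_supp_inter]
  rcases hint b hb b' hb' with h | h
  · exact absurd h hne
  · exact h

/-- **`|thirdConf| = 8 N`.** -/
theorem card_thirdConf (hm : m ≤ 16) (htb : ∀ b < N, popK 24 24 (tb b) = 3 ∧ tb b < 2 ^ m)
    (hint : ∀ b < N, ∀ b' < N, b = b' ∨ popK 24 24 (tb b &&& tb b') ≤ 1) : (thirdConf N tb).card = 8 * N := by
  have hdisj : ∀ b ∈ range N, ∀ b' ∈ range N, b ≠ b' →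
      Disjoint (blockVecs (supp (tb b))) (blockVecs (supp (tb b'))) := by
    intro b hb b' hb' hne
    rw [mem_range] at hb hb'
    rw [Finset.disjoint_left]
    intro x hx hx'
    have h1 := nz_of_mem_blockVecs (supp_tb_sub hm htb hb) hx
    have h2 := nz_of_mem_blockVecs (supp_tb_sub hm htb hb') hx'
    have h3 := card_tb_inter hint hb hb' hne
    rw [← h1.symm.trans h2, Finset.inter_self, card_supp_tb htb hb] at h3
    omega
  rw [thirdConf, card_biUnion hdisj]
  rw [Finset.sum_congr rfl fun b hb => by
    rw [card_blockVecs (supp_tb_sub hm htb (mem_range.mp hb)), card_supp_tb htb (mem_range.mp hb)]]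
  simp [mul_comm]

/-- Every vector is a pattern vector on a triple of cells `< m`, with norm `3`. -/
theorem exists_pvec_of_mem_thirdConf (hm : m ≤ 16) (htb : ∀ b < N, popK 24 24 (tb b) = 3 ∧ tb b < 2 ^ m)
    {x : Fin 24 → ℤ} (hx : x ∈ thirdConf N tb) :
    ∃ S : Finset (Fin 24), ∃ f : Fin 24 → Bool, (∀ j ∈ S, j.val < m) ∧ x = pvec S f 1 0 ∧ ip x x = 3 := by
  obtain ⟨b, hb, hxb⟩ := mem_biUnion.mp hx
  rw [mem_range] at hb
  obtain ⟨T, _, rfl⟩ := mem_blockVecs.mp hxb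
  refine ⟨_, _, fun j hj => val_lt_of_mem_supp_lt (htb b hb).2 hj, rfl, ?_⟩
  rw [ip_pvec_self (supp_tb_sub hm htb hb), card_supp_tb htb hb]; norm_num

/-- **Pairwise inner products `≤ 1`** (a third of the norm). -/
theorem ip_le_of_mem_thirdConf (hm : m ≤ 16) (htb : ∀ b < N, popK 24 24 (tb b) = 3 ∧ tb b < 2 ^ m)
    (hint : ∀ b < N, ∀ b' < N, b = b' ∨ popK 24 24 (tb b &&& tb b') ≤ 1)
    {x y : Fin 24 → ℤ} (hx : x ∈ thirdConf N tb) (hy : y ∈ thirdConf N tb) (hne : x ≠ y) : ip x y ≤ 1 := by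
  obtain ⟨b, hb, hxb⟩ := mem_biUnion.mp hx
  obtain ⟨b', hb', hyb⟩ := mem_biUnion.mp hy
  rw [mem_range] at hb hb'
  obtain ⟨T, _, rfl⟩ := mem_blockVecs.mp hxb
  obtain ⟨T', _, rfl⟩ := mem_blockVecs.mp hyb
  have hS := supp_tb_sub hm htb hb
  by_cases hbb : b = b'
  · subst hbb
    have hne2 : ∃ j ∈ supp (tb b), decide (j ∈ T) ≠ decide (j ∈ T') := by
      by_contra hall
      push Not at hall
      exact hne (pvec_congr hall 1 0)
    obtain ⟨j, hj, hfj⟩ := hne2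
    rw [ip_pvec_pvec hS hS, Finset.inter_self, card_supp_tb htb hb]
    have hpos : (1 : ℤ) ≤ (((supp (tb b)).filter fun j => (decide (j ∈ T) ^^ decide (j ∈ T')) = true).card : ℤ) := by
      have : 0 < ((supp (tb b)).filter fun j => (decide (j ∈ T) ^^ decide (j ∈ T')) = true).card := by
        apply Finset.card_pos.mpr
        refine ⟨j, Finset.mem_filter.mpr ⟨hj, ?_⟩⟩
        revert hfj; cases decide (j ∈ T) <;> cases decide (j ∈ T') <;> simp
      exact_mod_cast this
    push_cast; linarith
  · have h := ip_pvec_pvec_le_inter hS (supp_tb_sub hm htb hb') (fun j => decide (j ∈ T)) (fun j => decide (j ∈ T'))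
      (by norm_num : (0 : ℤ) ≤ 1 * 1) 0 0
    have h2 : ((supp (tb b) ∩ supp (tb b')).card : ℤ) ≤ 1 := by exact_mod_cast card_tb_inter hint hb hb' hbb
    linarith

/-- **Generic theorem**: `N` three-subsets of `{0,…,m−1}` (`m ≤ 16`) pairwise meeting in at most one point give `8N` unit
vectors of `ℝᵐ` with pairwise inner products `≤ 1/3`. [cite: ConwaySloane1999, Ch. 5 §2.6] -/
theorem exists_code_third (hm : m ≤ 16) (htb : ∀ b < N, popK 24 24 (tb b) = 3 ∧ tb b < 2 ^ m)
    (hint : ∀ b < N, ∀ b' < N, b = b' ∨ popK 24 24 (tb b &&& tb b') ≤ 1) :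
    ∃ C : Finset (EuclideanSpace ℝ (Fin m)), C.card = 8 * N ∧ (∀ x ∈ C, ‖x‖ = 1) ∧
      (∀ x ∈ C, ∀ y ∈ C, x ≠ y → inner ℝ x y ≤ 1 / 3) := by
  set K := (thirdConf N tb).image (toE 3) with hK
  have hKc : K.card = 8 * N := by
    rw [hK, card_image_of_injective _ (toE_injective (by norm_num)), card_thirdConf hm htb hint]
  have hKn : ∀ p ∈ K, ‖p‖ = 1 := by
    intro p hp
    obtain ⟨x, hx, rfl⟩ := mem_image.mp hp
    obtain ⟨S, f, -, -, h3⟩ := exists_pvec_of_mem_thirdConf hm htb hx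
    exact norm_toE (by norm_num) (by rw [h3]; norm_num)
  have hKi : ∀ p ∈ K, ∀ q ∈ K, p ≠ q → inner ℝ p q ≤ 1 / 3 := by
    intro p hp q hq hpq
    obtain ⟨x, hx, rfl⟩ := mem_image.mp hp
    obtain ⟨y, hy, rfl⟩ := mem_image.mp hq
    have hxy : x ≠ y := fun h => hpq (by rw [h])
    rw [inner_toE (by norm_num), div_le_iff₀ (by norm_num)]
    have h : (ip x y : ℝ) ≤ 1 := by exact_mod_cast ip_le_of_mem_thirdConf hm htb hint hx hy hxy
    linarith
  have hKo : ∀ p ∈ K, ∀ i : Fin (24 - m),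
      inner ℝ (EuclideanSpace.single (⟨m + i.val, by omega⟩ : Fin 24) (1 : ℝ)) p = 0 := by
    intro p hp i
    obtain ⟨x, hx, rfl⟩ := mem_image.mp hp
    obtain ⟨S, f, hS, rfl, -⟩ := exists_pvec_of_mem_thirdConf hm htb hx
    rw [EuclideanSpace.inner_single_left, map_one, one_mul, toE_apply]
    have hj : (⟨m + i.val, by omega⟩ : Fin 24) ∉ S := fun h => by have := hS _ h; simp at this
    simp [pvec, hj]
  obtain ⟨C', hc, hno, hi, _⟩ := exists_transfer_orthogonal (m := 24) (n := m) (k := 24 - m) (by omega)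
    (fun i : Fin (24 - m) => EuclideanSpace.single (⟨m + i.val, by omega⟩ : Fin 24) (1 : ℝ))
    (linearIndependent_tail m (24 - m) (by omega)) K hKo
  refine ⟨C', by rw [hc, hKc], fun x' hx' => ?_, fun x' hx' y' hy' hne => ?_⟩
  · obtain ⟨x, hx, he⟩ := hno x' hx'
    rw [he]; exact hKn x hx
  · obtain ⟨x, hx, y, hy, hxy, he⟩ := hi x' hx' y' hy' hne
    rw [he]; exact hKi x hx y hy hxy

end Generic

/-! ### The reduced blocks through the last point of `blk9`, `blk10`, `blk11` -/

/-- Reduced blocks through the point `8` of `blk9` (`P₉ₐ`): `3`-subsets of `{0,…,7}` as bit masks. -/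
def tb8 (b : ℕ) : ℕ :=
  match b with
  | 0 => 14 | 1 => 21 | 2 => 56 | 3 => 67 | 4 => 100 | 5 => 137 | 6 => 162 | 7 => 208
  | _ => 0
/-- Reduced blocks through the point `9` of `blk10` (`P₁₀b`): `3`-subsets of `{0,…,8}` as bit masks. -/
def tb9 (b : ℕ) : ℕ :=
  match b with
  | 0 => 13 | 1 => 22 | 2 => 56 | 3 => 74 | 4 => 97 | 5 => 145 | 6 => 162 | 7 => 196 | 8 => 259 | 9 => 292 | 10 => 336 | 11 => 392
  | _ => 0
/-- Reduced blocks through the point `10` of `blk11` (`P₁₁c`): `3`-subsets of `{0,…,9}` as bit masks. -/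
def tb10 (b : ℕ) : ℕ :=
  match b with
  | 0 => 19 | 1 => 70 | 2 => 88 | 3 => 97 | 4 => 140 | 5 => 176 | 6 => 265 | 7 => 290 | 8 => 448 | 9 => 522 | 10 => 548 | 11 => 641 | 12 => 784
  | _ => 0

/-- Facts for `m = 8` (reduced blocks of `blk9` through the point `8`). -/
theorem tb8_facts : (∀ b < 8, popK 24 24 (tb8 b) = 3 ∧ tb8 b < 2 ^ 8) ∧
    ∀ b < 8, ∀ b' < 8, b = b' ∨ popK 24 24 (tb8 b &&& tb8 b') ≤ 1 := by
  constructor <;> decide +kernel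

/-- The `tb8` triples are exactly the blocks of `blk9` through the point `8`, with that point removed. -/
theorem tb8_from_blk9 : (∀ b < 8, ∃ b' < 18, (blk9 b').testBit 8 = true ∧ tb8 b = blk9 b' &&& 255) ∧
    ((range 18).filter fun b' => (blk9 b').testBit 8 = true).card = 8 := by
  constructor <;> decide +kernel

/-- Facts for `m = 9` (reduced blocks of `blk10` through the point `9`). -/
theorem tb9_facts : (∀ b < 12, popK 24 24 (tb9 b) = 3 ∧ tb9 b < 2 ^ 9) ∧
    ∀ b < 12, ∀ b' < 12, b = b' ∨ popK 24 24 (tb9 b &&& tb9 b') ≤ 1 := by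
  constructor <;> decide +kernel

/-- The `tb9` triples are exactly the blocks of `blk10` through the point `9`, with that point removed. -/
theorem tb9_from_blk10 : (∀ b < 12, ∃ b' < 30, (blk10 b').testBit 9 = true ∧ tb9 b = blk10 b' &&& 511) ∧
    ((range 30).filter fun b' => (blk10 b').testBit 9 = true).card = 12 := by
  constructor <;> decide +kernel

set_option maxRecDepth 100000 in
/-- Facts for `m = 10` (reduced blocks of `blk11` through the point `10`). -/
theorem tb10_facts : (∀ b < 13, popK 24 24 (tb10 b) = 3 ∧ tb10 b < 2 ^ 10) ∧
    ∀ b < 13, ∀ b' < 13, b = b' ∨ popK 24 24 (tb10 b &&& tb10 b') ≤ 1 := by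
  constructor <;> decide +kernel

set_option maxRecDepth 100000 in
/-- The `tb10` triples are exactly the blocks of `blk11` through the point `10`, with that point removed. -/
theorem tb10_from_blk11 : (∀ b < 13, ∃ b' < 35, (blk11 b').testBit 10 = true ∧ tb10 b = blk11 b' &&& 1023) ∧
    ((range 35).filter fun b' => (blk11 b').testBit 10 = true).card = 13 := by
  constructor <;> decide +kernel

/-! ### The theorems -/

/-- **`A(8, arccos 1/3) ≥ 64`** (from `P₉ₐ`; the Table 9.2 value). [cite: ConwaySloane1999, Ch. 9 Table 9.2] -/
theorem exists_code_third_64 : ∃ C : Finset (EuclideanSpace ℝ (Fin 8)),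
    C.card = 64 ∧ (∀ x ∈ C, ‖x‖ = 1) ∧ (∀ x ∈ C, ∀ y ∈ C, x ≠ y → inner ℝ x y ≤ 1 / 3) :=
  exists_code_third (N := 8) (by norm_num) tb8_facts.1 tb8_facts.2

/-- **`A(9, arccos 1/3) ≥ 96`** (from `P₁₀b`; the Table 9.2 value). [cite: ConwaySloane1999, Ch. 9 Table 9.2] -/
theorem exists_code_third_96 : ∃ C : Finset (EuclideanSpace ℝ (Fin 9)),
    C.card = 96 ∧ (∀ x ∈ C, ‖x‖ = 1) ∧ (∀ x ∈ C, ∀ y ∈ C, x ≠ y → inner ℝ x y ≤ 1 / 3) :=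
  exists_code_third (N := 12) (by norm_num) tb9_facts.1 tb9_facts.2

/-- **`A(10, arccos 1/3) ≥ 104`** (from `P₁₁c`; Table 9.2 lists no lower bound for `n = 10`). [cite: ConwaySloane1999, Ch. 5 §2.6] -/
theorem exists_code_third_104 : ∃ C : Finset (EuclideanSpace ℝ (Fin 10)),
    C.card = 104 ∧ (∀ x ∈ C, ‖x‖ = 1) ∧ (∀ x ∈ C, ∀ y ∈ C, x ≠ y → inner ℝ x y ≤ 1 / 3) :=
  exists_code_third (N := 13) (by norm_num) tb10_facts.1 tb10_facts.2

/-- **`64 ≤ A(8, arccos 1/3) ≤ 74` in Lean** (upper: the cell's kernel-checked three-point bound). [cite: ConwaySloane1999, Ch. 9 Table 9.2] -/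
theorem code_dim8_third_bracket :
    (∃ C : Finset (EuclideanSpace ℝ (Fin 8)), C.card = 64 ∧ (∀ x ∈ C, ‖x‖ = 1) ∧
      (∀ x ∈ C, ∀ y ∈ C, x ≠ y → inner ℝ x y ≤ 1 / 3)) ∧
    ∀ C : Finset (EuclideanSpace ℝ (Fin 8)), (∀ x ∈ C, ‖x‖ = 1) →
      (∀ x ∈ C, ∀ y ∈ C, x ≠ y → inner ℝ x y ≤ 1 / 3) → C.card ≤ 74 :=
  ⟨exists_code_third_64, ThreePointCert.C8T.code_dim8_third_le_74_sdp⟩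

/-- **`96 ≤ A(9, arccos 1/3) ≤ 99` in Lean** (upper: the cell's kernel-checked three-point bound). [cite: ConwaySloane1999, Ch. 9 Table 9.2] -/
theorem code_dim9_third_bracket :
    (∃ C : Finset (EuclideanSpace ℝ (Fin 9)), C.card = 96 ∧ (∀ x ∈ C, ‖x‖ = 1) ∧
      (∀ x ∈ C, ∀ y ∈ C, x ≠ y → inner ℝ x y ≤ 1 / 3)) ∧
    ∀ C : Finset (EuclideanSpace ℝ (Fin 9)), (∀ x ∈ C, ‖x‖ = 1) →
      (∀ x ∈ C, ∀ y ∈ C, x ≠ y → inner ℝ x y ≤ 1 / 3) → C.card ≤ 99 :=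
  ⟨exists_code_third_96, ThreePointCert.C9T.code_dim9_third_le_99_sdp⟩

/-- **`104 ≤ A(10, arccos 1/3) ≤ 135` in Lean** (upper: the cell's kernel-checked three-point bound). [cite: ConwaySloane1999, Ch. 5 §2.6] -/
theorem code_dim10_third_bracket :
    (∃ C : Finset (EuclideanSpace ℝ (Fin 10)), C.card = 104 ∧ (∀ x ∈ C, ‖x‖ = 1) ∧
      (∀ x ∈ C, ∀ y ∈ C, x ≠ y → inner ℝ x y ≤ 1 / 3)) ∧
    ∀ C : Finset (EuclideanSpace ℝ (Fin 10)), (∀ x ∈ C, ‖x‖ = 1) →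
      (∀ x ∈ C, ∀ y ∈ C, x ≠ y → inner ℝ x y ≤ 1 / 3) → C.card ≤ 135 :=
  ⟨exists_code_third_104, ThreePointCert.C10T.code_dim10_third_le_135_sdp⟩

end Summit.Ventures.PackingBounds.Config.ConsA
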